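import Literature.AlgebraicGeometry.HodgeTheory.EllipticCurvesCMTypeProductsHodgeConjecture
import Literature.AlgebraicGeometry.HodgeTheory.StablyNondegenerateProducts
import Literature.AlgebraicGeometry.HodgeTheory.FiniteProductsMixedPowersRetract
import Literature.AlgebraicGeometry.Motives.AbelianVarietyIsogenousProductOfSimples
import HarnessLib

/-!
# Every complex abelian variety isogenous to a product of elliptic curves is STABLY nondegenerate: `B = D` on all its powers (van Geemen 1994 Thm. 4.3 / Tate, Imai; Moonen–Zarhin 1999 condition (D)), PROVED

Family `hodge`, layer `Literature/AlgebraicGeometry/HodgeTheory`. Research context: cell `pub-hodge-ring2`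
(HONEST FRAMING: research route conditional on HC_CM; not a corollary; Q11.4-sentence-2 already refuted in
dim ≥ 3), Literature lane (lit seat, generation 52; a brick for «every abelian threefold satisfies (D)»).
UNCONDITIONAL; theorems only, no definition, no named fact, nothing here uses or asserts HC_CM; no step towards a
summit statement.

PUBLISHED STATEMENT. van Geemen, LNM 1594 (1994), Thm. 4.3 (Tate; Imai): «For an abelian variety `X` which is
isogeneous to a product of elliptic curves […] `Bᵖ(X) = Dᵖ(X)` for all `p`»; since every power of such an `X`
is again isogenous to a product of elliptic curves, `X` satisfies Moonen–Zarhin's condition (D) (Math. Ann. 315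
(1999), (1.8): `B•(Xⁿ) = D•(Xⁿ)` for all `n`; Gordon's survey Def. 7.6: "stably nondegenerate"). The tree proves
Thm. 4.3 on carriers with a multi-curve slot structure (`MultiEllSlots.tate_isDivisorGenerated`, file
`EllipticCurvesProductsHodgeConjecture`, at Riemann's theorem `deligneMilne1982_Thm_6_20_full_holds`) and for
`X` itself; this file adds the word STABLY: the powers `B^{M+1} = B^{M} × B` carry the sum slot structure
(`MultiEllSlots.sum`), so `B = D` holds on every power.

RESULTS (UNCONDITIONAL, no binder).
* `MultiEllSlots.exists_multiEllSlots_powSucc` — every power of a multi-curve-slotted abelian variety carries a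
  multi-curve slot structure over curves of the same family (colours `κ ⊕ ι ⊕ ⋯ ⊕ ι`).
* **`MultiEllSlots.isStablyNondegenerate`** — `B` with a multi-curve slot structure over elliptic curves
  (arbitrary: complex multiplication and isogenies allowed) is stably nondegenerate.
* `isStablyNondegenerate_multiPowSucc` — `E₀^{N₀+1} × ⋯ × E_r^{N_r+1}` is stably nondegenerate for arbitrary
  elliptic curves `Eᵢ`; `isStablyNondegenerate_of_isIsogenous_multiPowSucc` — so is everything isogenous to it;
  the Hodge conjecture for all powers of such (`hodgeConjectureFor_powSucc_of_isIsogenous_multiPowSucc`);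
  `isStablyNondegenerate_curve_prod_curve_prod_curve` — `E₁ × E₂ × E₃` for ARBITRARY elliptic curves (the
  abelian threefolds isogenous to products of elliptic curves: rows of Moonen–Zarhin's Thm. 0.1 (4) in dimension
  `3`; the surface `E₁ × E₂` is the cell's `Ring2.WeilCoverage.isStablyNondegenerate_prod_of_dim_eq_one`).
* §3 `exists_curve_prod_curve_isIsogenous_of_not_isSimple_surface` — a NON-simple abelian surface is isogenous to
  a product of two elliptic curves (Poincaré's complete reducibility, the tree's `poincare_complete_reducibility`);
  **`isStablyNondegenerate_curve_prod_surface_of_not_isSimple (hE : E.dim = 1) (hS2 : S.dim = 2) (hS : ¬ S.IsSimple)`**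
  — `E × S` is stably nondegenerate for EVERY elliptic curve `E` and every NON-simple abelian surface `S` (the
  threefold rows `E × S`, `S ∼ E′ × E″`, of Moonen–Zarhin's Thm. 0.1 (4)); `isStablyNondegenerate_surface_of_not_isSimple`.

## References
* [vanGeemen1994HodgeAV] B. van Geemen, LNM 1594 (1994), Thm. 4.3, Lemma 3.7, §2.4. [cite: vanGeemen1994HodgeAV, Thm. 4.3 and Lemma 3.7]
* [MoonenZarhin1999LowDim] B. Moonen, Yu. Zarhin, Math. Ann. 315 (1999) 711–733: (1.8) condition (D), Thm. 0.1 (4),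
  Cor. (3.9) [corpus: paper:arxiv-math_9901113 pp. 1, 6–7]. [cite: MoonenZarhin1999LowDim, Thm. 0.1 (4) and Cor. (3.9)]
* [Gordon1999HodgeAVSurvey] B. B. Gordon, App. B of Lewis (1999), Thm. 7.5 (1), Def. 7.6. [cite: Gordon1999HodgeAVSurvey, Thm. 7.5 and Def. 7.6]
* [LangeBirkenhake1992] H. Lange, Ch. Birkenhake, *Complex Abelian Varieties* (1992), Thm. 4.2.1. [cite: LangeBirkenhake1992, Thm. 4.2.1]
* [MumfordAV1970] D. Mumford, *Abelian Varieties* (1970), §19 Thm. 1 and Cor. 1 (pp. 173–174). [cite: MumfordAV1970, §19 Thm. 1 (pp. 173–174)]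
-/

noncomputable section

open CategoryTheory CategoryTheory.Limits Module

namespace Literature.AlgebraicGeometry.HodgeTheory

open Literature.AlgebraicGeometry.Motives (AbelianVariety)
open Literature.Barriers.HodgeConjecture

universe u

/-! ### §1 Powers of a multi-curve-slotted abelian variety carry multi-curve slot structures -/

section Slots

variable {ι : Type u} [Fintype ι] {E : ι → AbelianVariety ℂ} {B : AbelianVariety ℂ} {m : ι → ℕ}
  {g : (i : ι) → Fin (m i) → (B ⟶ E i)}

/-- `dim B^{M+1} > 0` for `dim B > 0` (`B^{M+1} = B^{M} × B`, `dim (X × Y) = dim X + dim Y`). [folklore] -/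
private theorem dim_powSucc_pos_of_dim_pos (hB : 0 < B.dim) : ∀ M : ℕ, 0 < (B.powSucc M).dim
  | 0 => hB
  | M + 1 => by
    change 0 < ((B.powSucc M).prod B).dim
    rw [Motives.AbelianVariety.dim_prod]
    exact Nat.add_pos_right _ hB

/-- **Every power `B^{M+1}` of an abelian variety with a multi-curve slot structure over the curves `E i`
carries a multi-curve slot structure over curves each of which is one of the `E i`** (induction on `M`:
`B^{M+1} = B^{M} × B` and `MultiEllSlots.sum`). [cite: LangeBirkenhake1992, Thm. 4.2.1] [cite: vanGeemen1994HodgeAV, §2.4] -/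
theorem MultiEllSlots.exists_multiEllSlots_powSucc (hg : MultiEllSlots E B m g) :
    ∀ M : ℕ, ∃ (κ : Type u) (_ : Fintype κ) (E' : κ → AbelianVariety ℂ) (m' : κ → ℕ)
      (g' : (k : κ) → Fin (m' k) → (B.powSucc M ⟶ E' k)), MultiEllSlots E' (B.powSucc M) m' g' ∧
        ∀ k, ∃ i, E' k = E i
  | 0 => ⟨ι, inferInstance, E, m, g, hg, fun i => ⟨i, rfl⟩⟩
  | M + 1 => by
    obtain ⟨κ, _, E', m', g', h', hE'⟩ := hg.exists_multiEllSlots_powSucc M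
    refine ⟨κ ⊕ ι, inferInstance, Sum.elim E' E, Sum.elim m' m, sumSlots g' g, h'.sum hg, fun k => ?_⟩
    rcases k with k | i
    · exact hE' k
    · exact ⟨i, rfl⟩

/-- **van Geemen 1994 Thm. 4.3 (Tate), STABLY: an abelian variety with a multi-curve slot structure over
arbitrary elliptic curves is stably nondegenerate** — `B = D` on every power `B^{M+1}`, i.e. Moonen–Zarhin's
condition (D). [cite: vanGeemen1994HodgeAV, Thm. 4.3] [cite: MoonenZarhin1999LowDim, §1 (1.8) condition (D) and Cor. (3.9)]
[cite: Gordon1999HodgeAVSurvey, Thm. 7.5 (1) and Def. 7.6] -/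
theorem MultiEllSlots.isStablyNondegenerate (hg : MultiEllSlots E B m g) (hE : ∀ i, (E i).dim = 1)
    (hB : 0 < B.dim) : IsStablyNondegenerate B := by
  intro M
  obtain ⟨κ, _, E', m', g', h', hE'⟩ := hg.exists_multiEllSlots_powSucc M
  refine h'.tate_isDivisorGenerated (fun k => ?_) (dim_powSucc_pos_of_dim_pos hB M)
  obtain ⟨i, hi⟩ := hE' k
  rw [hi]
  exact hE i

end Slots

/-! ### §2 Products of powers of arbitrary elliptic curves and their isogeny classes -/

section Products

/-- **`E₀^{N₀+1} × ⋯ × E_r^{N_r+1}` is stably nondegenerate for ARBITRARY complex elliptic curves `Eᵢ`**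
(complex multiplication and isogenies among them allowed). [cite: vanGeemen1994HodgeAV, Thm. 4.3]
[cite: MoonenZarhin1999LowDim, §1 (1.8) and Cor. (3.9)] -/
theorem isStablyNondegenerate_multiPowSucc (r : ℕ) (E : Fin (r + 1) → AbelianVariety ℂ) (N : Fin (r + 1) → ℕ)
    (hE : ∀ i, (E i).dim = 1) : IsStablyNondegenerate (multiPowSucc r E N) := by
  obtain ⟨E', m, g, hg, hE', -⟩ := exists_multiEllSlots_multiPowSucc_card r E N hE
  exact hg.isStablyNondegenerate (fun i => by rw [hE' i]; exact hE i) (dim_multiPowSucc_pos r E N hE)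

/-- **Everything isogenous to a product of powers of elliptic curves is stably nondegenerate** (condition (D)
is an isogeny invariant, van Geemen §3.6). [cite: vanGeemen1994HodgeAV, Thm. 4.3 and §3.6 (p. 236)]
[cite: MoonenZarhin1999LowDim, Cor. (3.9)] -/
theorem isStablyNondegenerate_of_isIsogenous_multiPowSucc (r : ℕ) (E : Fin (r + 1) → AbelianVariety ℂ)
    (N : Fin (r + 1) → ℕ) (hE : ∀ i, (E i).dim = 1) {X : AbelianVariety ℂ}
    (hX : X.IsIsogenous (multiPowSucc r E N)) : IsStablyNondegenerate X :=
  (isStablyNondegenerate_multiPowSucc r E N hE).of_isIsogenous hX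

/-- **The Hodge conjecture for every power of an abelian variety isogenous to a product of elliptic curves**,
unconditionally. [cite: vanGeemen1994HodgeAV, Thm. 4.3 and Lemma 3.7] -/
theorem hodgeConjectureFor_powSucc_of_isIsogenous_multiPowSucc (r : ℕ) (E : Fin (r + 1) → AbelianVariety ℂ)
    (N : Fin (r + 1) → ℕ) (hE : ∀ i, (E i).dim = 1) {X : AbelianVariety ℂ}
    (hX : X.IsIsogenous (multiPowSucc r E N)) (M : ℕ) :
    HodgeConjectureFor (X.powSucc M).dim (X.powSucc M).X :=
  (isStablyNondegenerate_of_isIsogenous_multiPowSucc r E N hE hX).hodgeConjectureFor_powSucc M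

/-- **`E₁ × E₂ × E₃` is stably nondegenerate for arbitrary elliptic curves** (the abelian threefolds isogenous to
a product of three elliptic curves: Moonen–Zarhin Thm. 0.1 (4) in dimension 3).
[cite: vanGeemen1994HodgeAV, Thm. 4.3] [cite: MoonenZarhin1999LowDim, Thm. 0.1 (4)] -/
theorem isStablyNondegenerate_curve_prod_curve_prod_curve {E₁ E₂ E₃ : AbelianVariety ℂ} (h₁ : E₁.dim = 1)
    (h₂ : E₂.dim = 1) (h₃ : E₃.dim = 1) : IsStablyNondegenerate ((E₁.prod E₂).prod E₃) := by
  have h := isStablyNondegenerate_multiPowSucc 2 ![E₁, E₂, E₃] (fun _ => 0)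
    (fun i => by fin_cases i <;> simp [h₁, h₂, h₃])
  exact h

/-- **Isogeny classes**: everything isogenous to `E₁ × E₂ × E₃` (arbitrary elliptic curves) is stably
nondegenerate. [cite: vanGeemen1994HodgeAV, Thm. 4.3 and §3.6 (p. 236)] -/
theorem isStablyNondegenerate_of_isIsogenous_curve_prod_curve_prod_curve {E₁ E₂ E₃ X : AbelianVariety ℂ}
    (h₁ : E₁.dim = 1) (h₂ : E₂.dim = 1) (h₃ : E₃.dim = 1)
    (hX : AbelianVariety.IsIsogenous X ((E₁.prod E₂).prod E₃)) : IsStablyNondegenerate X :=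
  (isStablyNondegenerate_curve_prod_curve_prod_curve h₁ h₂ h₃).of_isIsogenous hX

end Products

/-! ### §3 Non-simple abelian surfaces: `E × S` with `S ∼ E′ × E″` -/

section NonSimpleSurface

open Literature.AlgebraicGeometry.Motives.AbelianVariety

variable {E S : AbelianVariety ℂ}

/-- **A non-simple complex abelian surface is isogenous to a product of two elliptic curves** (Poincaré's complete
reducibility: an abelian subvariety `B ↪ S` with `0 < dim B < 2` has a complement `Z` with `B × Z → S` an isogeny,
`dim B = dim Z = 1`). [cite: MumfordAV1970, §19 Thm. 1 (pp. 173–174)] [cite: MoonenZarhin1999LowDim, §2 (2.2)] -/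
theorem exists_curve_prod_curve_isIsogenous_of_not_isSimple_surface (hS2 : S.dim = 2) (hS : ¬ S.IsSimple) :
    ∃ E₁ E₂ : AbelianVariety ℂ, E₁.dim = 1 ∧ E₂.dim = 1 ∧ AbelianVariety.IsIsogenous (E₁.prod E₂) S := by
  obtain ⟨B, f, hf, hB0, hBS⟩ := exists_abelianSubvariety_of_not_isSimple hS
  haveI := hf
  obtain ⟨Z, j, -, hσ⟩ := poincare_complete_reducibility f
  have hdim : B.dim + Z.dim = S.dim := by
    rw [← dim_prod, ← dim_eq_of_isIsogeny (isIsogeny_hom_of_iso (biprodIsoProd B Z)), dim_eq_of_isIsogeny hσ]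
  refine ⟨B, Z, by omega, by omega, (biprodIsoProd B Z).inv ≫ biprod.desc f j, ?_⟩
  exact isIsogeny_comp (isIsogeny_hom_of_iso (biprodIsoProd B Z).symm) hσ

/-- **A non-simple abelian surface is stably nondegenerate** (`S ∼ E′ × E″`, Tate / van Geemen Thm. 4.3 stably).
[cite: vanGeemen1994HodgeAV, Thm. 4.3] [cite: MoonenZarhin1999LowDim, Thm. 0.1 (4)] -/
theorem isStablyNondegenerate_surface_of_not_isSimple (hS2 : S.dim = 2) (hS : ¬ S.IsSimple) : IsStablyNondegenerate S := by
  obtain ⟨E₁, E₂, h₁, h₂, hiso⟩ := exists_curve_prod_curve_isIsogenous_of_not_isSimple_surface hS2 hS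
  exact (isStablyNondegenerate_multiPowSucc 1 ![E₁, E₂] (fun _ => 0)
    (fun i => by fin_cases i <;> simp [h₁, h₂])).of_isIsogenous' hiso

/-- **`E × S` is stably nondegenerate for EVERY elliptic curve `E` and every NON-simple abelian surface `S`**
(`E × S ∼ E × E′ × E″`, a product of three elliptic curves; complex multiplication and isogenies allowed) — the
threefold rows `E × S`, `S` not simple, of Moonen–Zarhin's Thm. 0.1 (4): `B = D` on all powers. UNCONDITIONAL.
[cite: MoonenZarhin1999LowDim, Thm. 0.1 (4)] [cite: vanGeemen1994HodgeAV, Thm. 4.3] [cite: MumfordAV1970, §19 Thm. 1 (pp. 173–174)] -/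
theorem isStablyNondegenerate_curve_prod_surface_of_not_isSimple (hE : E.dim = 1) (hS2 : S.dim = 2)
    (hS : ¬ S.IsSimple) : IsStablyNondegenerate (E.prod S) := by
  obtain ⟨E₁, E₂, h₁, h₂, hiso⟩ := exists_curve_prod_curve_isIsogenous_of_not_isSimple_surface hS2 hS
  obtain ⟨F₁, m₁, g₁, hg₁, hF₁, -⟩ := exists_multiEllSlots_multiPowSucc_card 0 ![E] (fun _ => 0)
    (fun i => by fin_cases i; simpa using hE)
  obtain ⟨F₂, m₂, g₂, hg₂, hF₂, -⟩ := exists_multiEllSlots_multiPowSucc_card 1 ![E₁, E₂] (fun _ => 0)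
    (fun i => by fin_cases i <;> simp [h₁, h₂])
  have h : IsStablyNondegenerate (E.prod (E₁.prod E₂)) :=
    (hg₁.sum hg₂).isStablyNondegenerate (fun k => by
        rcases k with k | k
        · simp only [Sum.elim_inl, hF₁]; fin_cases k; simpa using hE
        · simp only [Sum.elim_inr, hF₂]; fin_cases k <;> simp [h₁, h₂])
      (by change 0 < (E.prod (E₁.prod E₂)).dim; rw [Motives.AbelianVariety.dim_prod, hE]; omega)
  exact h.of_isIsogenous' ((AbelianVariety.IsIsogenous.refl E).prod hiso)

/-- **All `E^{M+1} × S^{N+1}`, `B = D` on them and the Hodge conjecture for them**, for `E` an elliptic curve and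
`S` a non-simple abelian surface. [cite: MoonenZarhin1999LowDim, Thm. 0.1 (4)] [cite: vanGeemen1994HodgeAV, Thm. 4.3 and §2.4] -/
theorem hodgeConjectureFor_powSucc_curve_prod_powSucc_surface_of_not_isSimple (hE : E.dim = 1) (hS2 : S.dim = 2)
    (hS : ¬ S.IsSimple) (M N : ℕ) :
    HodgeConjectureFor ((E.powSucc M).prod (S.powSucc N)).dim ((E.powSucc M).prod (S.powSucc N)).X :=
  ((isStablyNondegenerate_curve_prod_surface_of_not_isSimple hE hS2 hS).powSucc_prod_powSucc M N).hodgeConjectureFor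

end NonSimpleSurface


end Literature.AlgebraicGeometry.HodgeTheory
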